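import Summits.RiemannHypothesis.RiemannHypothesis.Theorems.GroundBartaPolarPerronFrobeniusTruncatedConeGap
import Summits.RiemannHypothesis.RiemannHypothesis.Theorems.GroundBartaPolarPerronFrobeniusTruncatedSymbolBound
import Summits.RiemannHypothesis.RiemannHypothesis.Theorems.GroundBartaPolarPerronFrobeniusTruncatedSpreadTests
import Summits.RiemannHypothesis.RiemannHypothesis.Theorems.GroundBartaPolarPerronFrobeniusEvenThreshold
import Mathlib.Analysis.Complex.ExponentialBounds
import Literature.Analysis.SpecialFunctions.DigammaReflection
import HarnessLib

/-!
# RiemannHypothesis / GroundBarta — crux `PolarPerronFrobenius` (stmt-RiemannHypothesis-18390):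
# the PRIME-TRUNCATION BARRIER, part 3/3 — Perron–Frobenius (even cone density) FAILS for every
# finite-prime truncation of Weil's form at all large windows

Helper file (`--supports`), RH-free, Mathlib + proved tree files only, no definitions.

**Theorem (prime-truncation barrier).** For every `N` there is a height `a₀(N)` such that at every window
`a ≥ a₀(N)` the finite-prime form `E_N` (`Literature.NumberTheory.LFunctions.weilFinitePrimeQuadratic`; `N ≤ 1`:
Yoshida's prime-free form `weilArchQuadratic`) has an even, real-valued, `L²`-normalised Weil test `h` supported
in `[−a, a]` whose energy lies `≥ 2` BELOW the energy of every real non-negative normalised test (any support):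
`E_N(h) + 2 ≤ E_N(w)` (`pt_truncated_barrier`).  Consequences at every such window:
* the non-negative even cone is NOT energy-dense among even tests — the S1 matrix of the crux's line
  (`stub_evenConeDense_cofinal`, Cruxes/PolarPerronFrobenius/Lines/Sketch.lean) with `Re Q` replaced by `E_N`
  FAILS (`pt_truncated_evenConeDense_fails`);
* every near-minimising even test of `E_N` is far from the cone; the witness `h` takes both signs
  (`pt_truncated_witness_signChanging`).
In contrast, on the small windows `0 < a ≤ 11/40` — where `Re Q = E` because no prime reaches
(`weilQuadratic_re_eq_weilFinitePrimeQuadratic`) — even cone density HOLDS (tree, `et_evenConeDense`):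
`pt_primeFree_dichotomy` records both halves for the prime-free form.  So Perron–Frobenius persistence under
the polar term is a finite-window phenomenon for every truncation: whatever one-signedness the true Weil ground
state has at large windows (the crux: cofinally) is owed to the prime sum growing with the window — it is
invisible to the archimedean + polar structure and to any fixed finite set of primes.  (Numerics, kit j050064:
the prime-free even bottom state is nodeless at `a = 0.275, 0.3466` and has one node from `a = 0.45` on, while
the full form's even bottom state is nodeless at `a = 0.45, 0.55, 0.75`.)
Ingredients: part 1 (`pt_weilFinitePrimeQuadratic_ge_of_nonneg`: cone floor `ψ(1/4) − log π + 24/5 − 2Ψ_N`),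
part 2a (`pt_weilFinitePrimeQuadratic_le`: symbol-bottom upper bound), part 2b
(`pt_exists_spread_polarFree_even_test`: polar-free even spread tests with `‖w'‖² ≤ C/a²`).
Prover B, speedrun unit `sr-gb-rung-b` (rung 3).

References: H. Yoshida, Adv. Stud. Pure Math. 21 (1992) §2, §6; E. Bombieri, Rend. Lincei (9) 11 (2000) Thm 2;
A. Connes, C. Consani, arXiv:2106.01715 §2.3 (semi-local forms with finitely many primes).
-/

set_option linter.dupNamespace false

noncomputable section

open Set MeasureTheory Filter Complex
open scoped Real Topology ComplexConjugate

namespace Summit.RiemannHypothesis.RiemannHypothesis.Theorems.PolarPerronFrobenius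

open Literature.NumberTheory.LFunctions Literature.Analysis.SpecialFunctions

variable {g : ℝ → ℂ}

/-! ## Bookkeeping -/

/-- `E_N(−g) = E_N(g)`. [folklore] -/
theorem pt_weilFinitePrimeQuadratic_neg (N : ℕ) (g : ℝ → ℂ) :
    weilFinitePrimeQuadratic N (fun t ↦ -g t) = weilFinitePrimeQuadratic N g := by
  have e : (fun t ↦ -g t) = fun t ↦ (-1 : ℂ) * g t := by funext t; ring
  rw [e]
  unfold weilFinitePrimeQuadratic
  rw [pt_weilNorm2Sq_const_mul]
  simp only [weilMellin_const_mul, norm_mul, norm_neg, norm_one, one_mul, one_pow, map_mul, map_neg,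
    map_one]
  congr 3
  ring

/-- `−g` is a Weil test. [folklore] -/
theorem pt_isWeilTest_neg (hg : IsWeilTest g) : IsWeilTest fun t ↦ -g t := by
  have e : (fun t ↦ -g t) = fun t ↦ (-1 : ℂ) * g t := by funext t; ring
  rw [e]; exact hg.const_mul _

/-- `weilNorm2Sq g = ∫ ‖g‖²` (bridge to the crux's normalisation clause). [folklore] -/
theorem pt_weilNorm2Sq_eq (g : ℝ → ℂ) : weilNorm2Sq g = ∫ t, ‖g t‖ ^ 2 := rfl

/-! ## The barrier -/

/-- **THE PRIME-TRUNCATION BARRIER.** For every `N` there is `a₀ ≥ 1` such that every window `a ≥ a₀` carries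
an even, real-valued, `L²`-normalised Weil test `h` supported in `[−a, a]`, with `ĥ(0) = ĥ(1) = 0`, whose
`E_N`-energy is at least `2` below that of EVERY real non-negative `L²`-normalised Weil test:
`E_N(h) + 2 ≤ E_N(w)`. [cite: Yoshida1992, §2 eq. (2.1), §6] -/
theorem pt_truncated_barrier (N : ℕ) :
    ∃ a₀ : ℝ, 1 ≤ a₀ ∧ ∀ a : ℝ, a₀ ≤ a → ∃ h : ℝ → ℂ,
      IsWeilTest h ∧ tsupport h ⊆ Icc (-a) a ∧ (∀ t, h (-t) = h t) ∧ (∀ t, (h t).im = 0) ∧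
      weilMellin h 0 = 0 ∧ weilMellin h 1 = 0 ∧ weilNorm2Sq h = 1 ∧
      weilFinitePrimeQuadratic N h ≤ reDigammaQuarter 0 -
          2 * (∑ n ∈ Finset.range (N + 1), (ArithmeticFunction.vonMangoldt n : ℝ) / Real.sqrt n) -
          Real.log π + 1 ∧
      ∀ w : ℝ → ℂ, IsWeilTest w → (∀ t, (w t).im = 0 ∧ 0 ≤ (w t).re) → weilNorm2Sq w = 1 →
        weilFinitePrimeQuadratic N h + 2 ≤ weilFinitePrimeQuadratic N w := by
  obtain ⟨C, hC, a₁, ha₁, hspread⟩ := pt_exists_spread_polarFree_even_test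
  set Ψ := ∑ n ∈ Finset.range (N + 1), (ArithmeticFunction.vonMangoldt n : ℝ) / Real.sqrt n with hΨ
  set K := 27 + ∑ n ∈ Finset.range (N + 1),
      (ArithmeticFunction.vonMangoldt n : ℝ) / Real.sqrt n * Real.log n ^ 2 with hK
  have hK0 : 0 ≤ K := by
    have : 0 ≤ ∑ n ∈ Finset.range (N + 1),
        (ArithmeticFunction.vonMangoldt n : ℝ) / Real.sqrt n * Real.log n ^ 2 :=
      Finset.sum_nonneg fun n _ ↦ mul_nonneg
        (div_nonneg ArithmeticFunction.vonMangoldt_nonneg (Real.sqrt_nonneg _)) (sq_nonneg _)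
    linarith
  refine ⟨max a₁ (K * C + 1), le_trans ha₁ (le_max_left _ _), fun a ha ↦ ?_⟩
  have haa₁ : a₁ ≤ a := le_trans (le_max_left _ _) ha
  have haK : K * C + 1 ≤ a := le_trans (le_max_right _ _) ha
  have ha1 : 1 ≤ a := le_trans ha₁ haa₁
  obtain ⟨h, hh, hsupp, heven, hreal, hm0, hm1, hnorm, hderiv⟩ := hspread a haa₁
  -- upper bound for the witness
  have hup := pt_weilFinitePrimeQuadratic_le N hh
  rw [hm0, zero_mul, Complex.zero_re, mul_zero, zero_add, hnorm, mul_one] at hup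
  have hKC : K * weilNorm2Sq (deriv h) ≤ 1 := by
    have h1 : K * weilNorm2Sq (deriv h) ≤ K * (C / a ^ 2) := mul_le_mul_of_nonneg_left hderiv hK0
    have h2 : K * (C / a ^ 2) ≤ 1 := by
      rw [← mul_div_assoc, div_le_one (by positivity)]
      nlinarith
    linarith
  have hup' : weilFinitePrimeQuadratic N h ≤ reDigammaQuarter 0 - 2 * Ψ - Real.log π + 1 := by linarith
  refine ⟨h, hh, hsupp, heven, hreal, hm0, hm1, hnorm, hup', fun w hw hwreal hwnorm ↦ ?_⟩
  -- lower bound for the non-negative test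
  have hlow := pt_weilFinitePrimeQuadratic_ge_of_nonneg N hw hwreal
  rw [hwnorm, mul_one] at hlow
  linarith

/-! ## Consequences -/

/-- **Even cone density FAILS for `E_N` at every large window** — the S1 matrix of the crux's line
(`stub_evenConeDense_cofinal`) with `Re Q` replaced by the finite-prime form `E_N`. [cite: Yoshida1992, §2 eq. (2.1)] -/
theorem pt_truncated_evenConeDense_fails (N : ℕ) :
    ∃ a₀ : ℝ, 1 ≤ a₀ ∧ ∀ a : ℝ, a₀ ≤ a →
      ¬ (∀ h : ℝ → ℂ, IsWeilTest h → tsupport h ⊆ Icc (-a) a → (∀ t, h (-t) = h t) →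
          ∫ t, ‖h t‖ ^ 2 = (1 : ℝ) → ∀ δ : ℝ, 0 < δ →
          ∃ w : ℝ → ℂ, IsWeilTest w ∧ tsupport w ⊆ Icc (-a) a ∧ (∀ t, w (-t) = w t) ∧
            (∀ t, (w t).im = 0 ∧ 0 ≤ (w t).re) ∧ ∫ t, ‖w t‖ ^ 2 = (1 : ℝ) ∧
            weilFinitePrimeQuadratic N w ≤ weilFinitePrimeQuadratic N h + δ) := by
  obtain ⟨a₀, ha₀, hbar⟩ := pt_truncated_barrier N
  refine ⟨a₀, ha₀, fun a ha hdense ↦ ?_⟩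
  obtain ⟨h, hh, hsupp, heven, -, -, -, hnorm, -, hgap⟩ := hbar a ha
  obtain ⟨w, hw, -, -, hwreal, hwnorm, hwle⟩ := hdense h hh hsupp heven hnorm 1 one_pos
  have := hgap w hw hwreal hwnorm
  linarith

/-- **The witnesses change sign**: at every window `a ≥ a₀(N)` the barrier's even real normalised test `h`
takes a strictly negative AND a strictly positive value (neither `h` nor `−h` is in the cone, by the cone floor). [folklore] -/
theorem pt_truncated_witness_signChanging (N : ℕ) :
    ∃ a₀ : ℝ, 1 ≤ a₀ ∧ ∀ a : ℝ, a₀ ≤ a → ∃ h : ℝ → ℂ,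
      IsWeilTest h ∧ tsupport h ⊆ Icc (-a) a ∧ (∀ t, h (-t) = h t) ∧ (∀ t, (h t).im = 0) ∧
      weilNorm2Sq h = 1 ∧ (∃ t, (h t).re < 0) ∧ (∃ t, 0 < (h t).re) ∧
      ∀ w : ℝ → ℂ, IsWeilTest w → (∀ t, (w t).im = 0 ∧ 0 ≤ (w t).re) → weilNorm2Sq w = 1 →
        weilFinitePrimeQuadratic N h + 2 ≤ weilFinitePrimeQuadratic N w := by
  obtain ⟨a₀, ha₀, hbar⟩ := pt_truncated_barrier N
  refine ⟨a₀, ha₀, fun a ha ↦ ?_⟩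
  obtain ⟨h, hh, hsupp, heven, hreal, -, -, hnorm, -, hgap⟩ := hbar a ha
  refine ⟨h, hh, hsupp, heven, hreal, hnorm, ?_, ?_, hgap⟩
  · by_contra hneg
    push Not at hneg
    have := hgap h hh (fun t ↦ ⟨hreal t, hneg t⟩) hnorm
    linarith
  · by_contra hpos
    push Not at hpos
    have hn : IsWeilTest fun t ↦ -h t := pt_isWeilTest_neg hh
    have hnreal : ∀ t, ((fun t ↦ -h t) t).im = 0 ∧ 0 ≤ ((fun t ↦ -h t) t).re := fun t ↦ by
      simp only [Complex.neg_im, Complex.neg_re, hreal t, neg_zero, true_and]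
      linarith [hpos t]
    have hnnorm : weilNorm2Sq (fun t ↦ -h t) = 1 := by
      rw [← hnorm]; unfold weilNorm2Sq; simp only [norm_neg]
    have := hgap _ hn hnreal hnnorm
    rw [pt_weilFinitePrimeQuadratic_neg] at this
    linarith

/-- **No truncation is positive at large windows**: for every `N`, at every window `a ≥ a₀(N)` some even real
`L²`-normalised Weil test on `[−a, a]` has `E_N`-energy `≤ ψ(1/4) − log π + 1 < −2` (`ψ(1/4) = −γ − π/2 − 3 log 2`);
finite-prime certificates of Weil positivity cannot reach beyond a bounded window. [cite: Yoshida1992, §2 eq. (2.1)] -/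
theorem pt_truncated_negative_energy (N : ℕ) :
    ∃ a₀ : ℝ, 1 ≤ a₀ ∧ ∀ a : ℝ, a₀ ≤ a → ∃ h : ℝ → ℂ,
      IsWeilTest h ∧ tsupport h ⊆ Icc (-a) a ∧ (∀ t, h (-t) = h t) ∧ (∀ t, (h t).im = 0) ∧
      weilNorm2Sq h = 1 ∧ weilFinitePrimeQuadratic N h < -2 := by
  obtain ⟨a₀, ha₀, hbar⟩ := pt_truncated_barrier N
  refine ⟨a₀, ha₀, fun a ha ↦ ?_⟩
  obtain ⟨h, hh, hsupp, heven, hreal, -, -, hnorm, hup, -⟩ := hbar a ha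
  refine ⟨h, hh, hsupp, heven, hreal, hnorm, ?_⟩
  have hΨ : 0 ≤ ∑ n ∈ Finset.range (N + 1), (ArithmeticFunction.vonMangoldt n : ℝ) / Real.sqrt n :=
    Finset.sum_nonneg fun n _ ↦ div_nonneg ArithmeticFunction.vonMangoldt_nonneg (Real.sqrt_nonneg _)
  have hψ : reDigammaQuarter 0 ≤ -3 := by
    rw [reDigammaQuarter_zero, Literature.Analysis.SpecialFunctions.Complex.digamma_one_quarter_eq_neg_ofReal,
      ← Complex.ofReal_neg, Complex.ofReal_re]
    have h1 : (1 / 2 : ℝ) < Real.eulerMascheroniConstant := Real.one_half_lt_eulerMascheroniConstant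
    have h2 := Real.log_two_gt_d9
    have h3 := Real.pi_gt_three
    norm_num at h2
    linarith
  have hlogpi : 0 < Real.log π := Real.log_pos (by linarith [Real.pi_gt_three])
  linarith

/-! ## The prime-free dichotomy: Perron–Frobenius holds on `(0, 11/40]` and fails at all large windows -/

/-- `11/40 ≤ (log 2)/2`: the certified small windows see no prime. [folklore] -/
theorem pt_eleven_fortieths_le_log_two_half : (11 / 40 : ℝ) ≤ Real.log ((1 : ℕ) + 1) / 2 := by
  have := Real.log_two_gt_d9
  norm_num at this ⊢
  linarith

/-- **THE PRIME-FREE DICHOTOMY.** For Yoshida's polar + archimedean form `E = E₁ = weilArchQuadratic`: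
(i) at every window `0 < a ≤ 11/40` the non-negative even cone IS energy-dense among even `L²`-normalised tests
(tree: `et_evenConeDense`, where `Re Q = E` since no prime reaches), whereas (ii) there is `a₀` beyond which, at
EVERY window, it is NOT. Perron–Frobenius persistence under the rank-one polar term is a finite-window phenomenon
of the prime-free form; cofinal one-signedness (the crux) must come from the primes. [cite: Yoshida1992, §2 eq. (2.1), §6] -/
theorem pt_primeFree_dichotomy :
    (∀ a : ℝ, 0 < a → a ≤ 11 / 40 →
      ∀ h : ℝ → ℂ, IsWeilTest h → tsupport h ⊆ Icc (-a) a → (∀ t, h (-t) = h t) →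
        ∫ t, ‖h t‖ ^ 2 = (1 : ℝ) → ∀ δ : ℝ, 0 < δ →
        ∃ w : ℝ → ℂ, IsWeilTest w ∧ tsupport w ⊆ Icc (-a) a ∧ (∀ t, w (-t) = w t) ∧
          (∀ t, (w t).im = 0 ∧ 0 ≤ (w t).re) ∧ ∫ t, ‖w t‖ ^ 2 = (1 : ℝ) ∧
          weilFinitePrimeQuadratic 1 w ≤ weilFinitePrimeQuadratic 1 h + δ) ∧
    (∃ a₀ : ℝ, 1 ≤ a₀ ∧ ∀ a : ℝ, a₀ ≤ a →
      ¬ (∀ h : ℝ → ℂ, IsWeilTest h → tsupport h ⊆ Icc (-a) a → (∀ t, h (-t) = h t) →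
          ∫ t, ‖h t‖ ^ 2 = (1 : ℝ) → ∀ δ : ℝ, 0 < δ →
          ∃ w : ℝ → ℂ, IsWeilTest w ∧ tsupport w ⊆ Icc (-a) a ∧ (∀ t, w (-t) = w t) ∧
            (∀ t, (w t).im = 0 ∧ 0 ≤ (w t).re) ∧ ∫ t, ‖w t‖ ^ 2 = (1 : ℝ) ∧
            weilFinitePrimeQuadratic 1 w ≤ weilFinitePrimeQuadratic 1 h + δ)) := by
  refine ⟨fun a ha ha' h hh hsupp heven hnorm δ hδ ↦ ?_, pt_truncated_evenConeDense_fails 1⟩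
  have hwin : Icc (-a) a ⊆ Icc (-(Real.log ((1 : ℕ) + 1) / 2)) (Real.log ((1 : ℕ) + 1) / 2) := by
    have := pt_eleven_fortieths_le_log_two_half
    exact Icc_subset_Icc (by linarith) (by linarith)
  obtain ⟨w, hw, hwsupp, hweven, hwreal, hwnorm, hwle⟩ := et_evenConeDense ha ha' h hh hsupp heven hnorm δ hδ
  refine ⟨w, hw, hwsupp, hweven, hwreal, hwnorm, ?_⟩
  rw [← weilQuadratic_re_eq_weilFinitePrimeQuadratic hw 1 (hwsupp.trans hwin),
    ← weilQuadratic_re_eq_weilFinitePrimeQuadratic hh 1 (hsupp.trans hwin)]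
  exact hwle

/-- The same dichotomy spelled with `weilArchQuadratic` (`E₁ = E`, `pt_weilFinitePrimeQuadratic_eq_weilArchQuadratic`):
at windows `a ≤ 11/40` every even normalised test is matched up to any `δ > 0` by a non-negative even one; beyond
`a₀` some even normalised test is not matched up to `δ = 1`. [cite: Yoshida1992, §2 eq. (2.1), §6] -/
theorem pt_primeFree_dichotomy_weilArchQuadratic :
    (∀ a : ℝ, 0 < a → a ≤ 11 / 40 →
      ∀ h : ℝ → ℂ, IsWeilTest h → tsupport h ⊆ Icc (-a) a → (∀ t, h (-t) = h t) →
        ∫ t, ‖h t‖ ^ 2 = (1 : ℝ) → ∀ δ : ℝ, 0 < δ →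
        ∃ w : ℝ → ℂ, IsWeilTest w ∧ tsupport w ⊆ Icc (-a) a ∧ (∀ t, w (-t) = w t) ∧
          (∀ t, (w t).im = 0 ∧ 0 ≤ (w t).re) ∧ ∫ t, ‖w t‖ ^ 2 = (1 : ℝ) ∧
          weilArchQuadratic w ≤ weilArchQuadratic h + δ) ∧
    (∃ a₀ : ℝ, 1 ≤ a₀ ∧ ∀ a : ℝ, a₀ ≤ a → ∃ h : ℝ → ℂ,
      IsWeilTest h ∧ tsupport h ⊆ Icc (-a) a ∧ (∀ t, h (-t) = h t) ∧ (∀ t, (h t).im = 0) ∧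
      ∫ t, ‖h t‖ ^ 2 = (1 : ℝ) ∧
      ∀ w : ℝ → ℂ, IsWeilTest w → (∀ t, (w t).im = 0 ∧ 0 ≤ (w t).re) → ∫ t, ‖w t‖ ^ 2 = (1 : ℝ) →
        weilArchQuadratic h + 2 ≤ weilArchQuadratic w) := by
  obtain ⟨hsmall, -⟩ := pt_primeFree_dichotomy
  obtain ⟨a₀, ha₀, hbar⟩ := pt_truncated_barrier 1
  refine ⟨fun a ha ha' h hh hsupp heven hnorm δ hδ ↦ ?_, a₀, ha₀, fun a ha ↦ ?_⟩
  · obtain ⟨w, hw, hwsupp, hweven, hwreal, hwnorm, hwle⟩ := hsmall a ha ha' h hh hsupp heven hnorm δ hδ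
    refine ⟨w, hw, hwsupp, hweven, hwreal, hwnorm, ?_⟩
    rwa [pt_weilFinitePrimeQuadratic_eq_weilArchQuadratic le_rfl,
      pt_weilFinitePrimeQuadratic_eq_weilArchQuadratic le_rfl] at hwle
  · obtain ⟨h, hh, hsupp, heven, hreal, -, -, hnorm, -, hgap⟩ := hbar a ha
    refine ⟨h, hh, hsupp, heven, hreal, hnorm, fun w hw hwreal hwnorm ↦ ?_⟩
    have := hgap w hw hwreal hwnorm
    rwa [pt_weilFinitePrimeQuadratic_eq_weilArchQuadratic le_rfl,
      pt_weilFinitePrimeQuadratic_eq_weilArchQuadratic le_rfl] at this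

end Summit.RiemannHypothesis.RiemannHypothesis.Theorems.PolarPerronFrobenius
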